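import Summits.Ventures.PercRepro.C041TriDomExcessForced

/-!
# ROW C-041 — THE SYMMETRIC EXCESS AT EVERY EDGE PROBABILITY: `P(⊤,⊥) + P(⊥,⊤) ≥ Σ_{i ≠ j} P(s_i, s_j)`
for all edge probabilities `p_e ∈ [½, 1]` — and, by complementation, all `p_e ∈ [0, ½]`; uniform `p ∈ [0, 1]`
(p6, gen 42; P6-TWOEXIT-LEAN.md §53 ADDENDUM 6)

Each edge `e` is red with probability `w e` and blue with probability `1 − w e`, independently (`wt`, `cwt`); the
weighted symmetrised excess `esymW R st w = Σ_ω cwt w ω · Fsym (rsigF R st ω) (bsig st ω)` is the EXPECTATION of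
the symmetrised functional under the product measure (with the forced-red edges `R` and the statuses `st` of
`C041TriDomExcessForced`).  THE MIXTURE: an edge red with probability `p ≥ ½` is a forced-red edge with probability
`2p − 1` and a fair edge with probability `2 − 2p`; pointwise, at a free edge `f` of probability `p = w f`,
  `p·Fsym(σ′,τ) + (1 − p)·Fsym(σ,τ′) = (2p − 1)·Fsym(σ′,τ) + (1 − p)·[Fsym(σ′,τ) + Fsym(σ,τ′)]
                                     ≥ (2p − 1)·Fsym(σ′,τ) + (1 − p)·[Fsym(σ,τ) + Fsym(σ′,τ′)]`
by THE KEY LEMMA (`gapFr_nonneg`), where `(σ′,τ)` is the pair of the forced-red status of `f` (`rsigF_forced_eq`: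
forcing `f` red is the contraction of `f` for the red pattern and the deletion of `f` for the blue one).  Summed with
the weights this is **THE WEIGHTED RECURSION** (`esymW_rec_ge`): the weighted excess is at least
`(2p − 1)·(f forced red) + (1 − p)·[(f deleted) + (f contracted)]`, three statuses with one free edge fewer.  The
induction on the free edges (`esymW_nonneg`) has the base case of THEOREM (FORCED RED): without free edges the blue
pattern refines the red one and `Fsym` is non-negative there.  Hence **THEOREM (THE SYMMETRIC EXCESS AT EVERY
EDGE PROBABILITY ≥ ½)** `esymP_nonneg_of_half_le`, the complementary statement for `p_e ≤ ½` (`esymP_nonneg_of_le_half`,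
by the complementation `ZoneData.cpl`, which exchanges the patterns and the probabilities `w ↦ 1 − w`), the uniform
case `p ∈ [0, 1]` (`esymP_nonneg_uniform`), and the statement in probabilities (`probPat`):
  `P(s₁,s₂) + P(s₂,s₁) + P(s₁,s₃) + P(s₃,s₁) + P(s₂,s₃) + P(s₃,s₂) ≤ P(⊤,⊥) + P(⊥,⊤)`
(`probPat_crossed_le_of_half_le`, `probPat_crossed_le_of_le_half`, `probPat_crossed_le_uniform`) — the excess
inequality of §53 at every edge probability, in its symmetric form.  (With probabilities on BOTH sides of `½` the
statement is false in general: forced red and forced blue edges together, §53 ADDENDUM 5.)  THIS MODULE: the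
weights, THE DOUBLING LEMMA, THE WEIGHTED RECURSION, `esymW_nonneg` and `esymP_nonneg_of_half_le`; the
complementation, the uniform case and the statement in probabilities are in `C041TriDomExcessWeightedProb`.
-/

namespace PercRepro

namespace ZoneZ

namespace MultiExit

open ZoneData Finset

variable {V₁ E₁ U₁ U₂ : Type} (Z₁ : ZoneData V₁ E₁ U₁ U₂) (u u' a₁ : V₁)

/-! ## Edge probabilities and the weight of a colouring -/

/-- The weight of the colour `b` of an edge that is red with probability `p`: `p` if red, `1 − p` if blue. -/
def wt (p : ℚ) (b : Bool) : ℚ := if b then p else 1 - p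

/-- The two colours of an edge have total weight one. -/
theorem wt_add_wt_not (p : ℚ) (b : Bool) : wt p b + wt p (!b) = 1 := by
  cases b <;> simp [wt]

/-- Weights are non-negative for probabilities in `[0, 1]`. -/
theorem wt_nonneg {p : ℚ} (h0 : 0 ≤ p) (h1 : p ≤ 1) (b : Bool) : 0 ≤ wt p b := by
  cases b <;> simp only [wt, Bool.false_eq_true, if_false, if_true] <;> linarith

/-- The weight of the complementary colour is the weight at the complementary probability. -/
theorem wt_not_eq (p : ℚ) (b : Bool) : wt p (!b) = wt (1 - p) b := by
  cases b <;> simp [wt]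

variable [Fintype E₁]

/-- The weight of a colouring under the edge probabilities `w`: the product of the weights of its colours. -/
def cwt (w : E₁ → ℚ) (ω : E₁ → Bool) : ℚ := ∏ e, wt (w e) (ω e)

/-- Colouring weights are non-negative for probabilities in `[0, 1]`. -/
theorem cwt_nonneg {w : E₁ → ℚ} (hw : ∀ e, 0 ≤ w e ∧ w e ≤ 1) (ω : E₁ → Bool) : 0 ≤ cwt w ω :=
  Finset.prod_nonneg fun e _ => wt_nonneg (hw e).1 (hw e).2 (ω e)

/-- The weight of the complemented colouring is the weight at the complementary probabilities. -/
theorem cwt_cpl (w : E₁ → ℚ) (ω : E₁ → Bool) : cwt w (ZoneData.cpl ω) = cwt (fun e => 1 - w e) ω := by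
  unfold cwt
  refine Finset.prod_congr rfl fun e _ => ?_
  exact wt_not_eq (w e) (ω e)

variable [DecidableEq E₁]

/-- The weight of a colouring without the factor of the edge `f`. -/
def cwt' (f : E₁) (w : E₁ → ℚ) (ω : E₁ → Bool) : ℚ := ∏ e ∈ univ.erase f, wt (w e) (ω e)

/-- The weight factors through the edge `f`. -/
theorem cwt_eq (f : E₁) (w : E₁ → ℚ) (ω : E₁ → Bool) : cwt w ω = wt (w f) (ω f) * cwt' f w ω := by
  unfold cwt cwt'
  rw [Finset.mul_prod_erase univ (fun e => wt (w e) (ω e)) (mem_univ f)]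

/-- The weight without `f` is non-negative. -/
theorem cwt'_nonneg {w : E₁ → ℚ} (hw : ∀ e, 0 ≤ w e ∧ w e ≤ 1) (f : E₁) (ω : E₁ → Bool) : 0 ≤ cwt' f w ω :=
  Finset.prod_nonneg fun e _ => wt_nonneg (hw e).1 (hw e).2 (ω e)

/-- The weight without `f` ignores the colour of `f`. -/
theorem cwt'_flip (f : E₁) (w : E₁ → ℚ) (ω : E₁ → Bool) : cwt' f w (flipC f ω) = cwt' f w ω := by
  unfold cwt'
  refine Finset.prod_congr rfl fun e he => ?_
  have hef : e ≠ f := Finset.ne_of_mem_erase he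
  simp [flipC, Function.update_of_ne hef]

/-- **THE DOUBLING LEMMA**: twice the weighted sum of a function invariant under the flip of `f` is its sum with the
weight of `f` removed (the two colours of `f` have total weight one). -/
theorem two_mul_sum_cwt_eq (f : E₁) (w : E₁ → ℚ) (H : (E₁ → Bool) → ℚ) (hH : ∀ ω, H (flipC f ω) = H ω) :
    2 * ∑ ω : E₁ → Bool, cwt w ω * H ω = ∑ ω : E₁ → Bool, cwt' f w ω * H ω := by
  have hflip : ∑ ω : E₁ → Bool, cwt w ω * H ω = ∑ ω : E₁ → Bool, cwt w (flipC f ω) * H (flipC f ω) :=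
    (Equiv.sum_comp (flipPerm f) (fun ω => cwt w ω * H ω)).symm
  have h2 : 2 * ∑ ω : E₁ → Bool, cwt w ω * H ω =
      ∑ ω : E₁ → Bool, (cwt w ω * H ω + cwt w (flipC f ω) * H (flipC f ω)) := by
    rw [Finset.sum_add_distrib, ← hflip]; ring
  rw [h2]
  refine Finset.sum_congr rfl fun ω _ => ?_
  rw [hH, cwt_eq f w ω, cwt_eq f w (flipC f ω), cwt'_flip, flipC_apply_self]
  have := wt_add_wt_not (w f) (ω f)
  linear_combination (cwt' f w ω * H ω) * this

/-! ## The forced-red status of an edge -/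

omit [Fintype E₁] in
/-- Forcing `f` red (deleting it from the status, adding it to the forced set) gives the red pattern of the
contraction of `f`. -/
theorem rsigF_forced_eq (R : E₁ → Prop) (st : E₁ → EStat) (f : E₁) (ω : E₁ → Bool) :
    rsigF Z₁ u u' a₁ (fun e => R e ∨ e = f) (Function.update st f .absent) ω =
      rsigF Z₁ u u' a₁ R (Function.update st f .double) ω := by
  have h : RAdjF Z₁ (fun e => R e ∨ e = f) (Function.update st f .absent) ω =
      RAdjF Z₁ R (Function.update st f .double) ω := by
    funext x y
    refine propext (exists_congr fun e => and_congr_right fun _ => ?_)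
    by_cases he : e = f
    · subst he; simp [redE]
    · simp [redE, he]
  simp only [rsigF, RdF, Prod.mk.injEq, decide_eq_decide, h, iff_self, and_self]

/-! ## The weighted symmetrised excess and its recursion -/

/-- The weighted symmetrised excess: the expectation of `Fsym (red pattern) (blue pattern)` under the product measure
with edge probabilities `w`, with the forced-red edges `R` and the statuses `st`. -/
noncomputable def esymW (R : E₁ → Prop) (st : E₁ → EStat) (w : E₁ → ℚ) : ℚ :=
  ∑ ω : E₁ → Bool, cwt w ω * (Fsym (rsigF Z₁ u u' a₁ R st ω) (bsig Z₁ u u' a₁ st ω) : ℚ)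

/-- Colouring `f` red or blue: the two weighted summands of the recursion. -/
theorem summandW_add_flip (R : E₁ → Prop) (st : E₁ → EStat) (w : E₁ → ℚ) (f : E₁) (hf : st f = .free)
    (ω : E₁ → Bool) :
    cwt w ω * (Fsym (rsigF Z₁ u u' a₁ R st ω) (bsig Z₁ u u' a₁ st ω) : ℚ)
        + cwt w (flipC f ω) * (Fsym (rsigF Z₁ u u' a₁ R st (flipC f ω)) (bsig Z₁ u u' a₁ st (flipC f ω)) : ℚ) =
      cwt' f w ω * (w f * (Fsym (rsigF Z₁ u u' a₁ R (Function.update st f .double) ω)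
          (bsig Z₁ u u' a₁ (Function.update st f .absent) ω) : ℚ)
        + (1 - w f) * (Fsym (rsigF Z₁ u u' a₁ R (Function.update st f .absent) ω)
          (bsig Z₁ u u' a₁ (Function.update st f .double) ω) : ℚ)) := by
  have hd : EStat.double ≠ EStat.free := by decide
  have ha : EStat.absent ≠ EStat.free := by decide
  rw [cwt_eq f w ω, cwt_eq f w (flipC f ω), cwt'_flip, flipC_apply_self]
  by_cases hω : ω f = true
  · have hω' : flipC f ω f = false := by simp [flipC_apply_self, hω]
    rw [rsigF_of_true Z₁ u u' a₁ R hf hω, bsig_of_true Z₁ u u' a₁ hf hω, rsigF_of_false Z₁ u u' a₁ R hf hω',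
      bsig_of_false Z₁ u u' a₁ hf hω']
    unfold flipC
    rw [rsigF_update_nonfree Z₁ u u' a₁ R st f ha, bsig_update_nonfree Z₁ u u' a₁ st f hd]
    simp only [hω, wt, Bool.not_true, if_true, Bool.false_eq_true, if_false]
    ring
  · have hω0 : ω f = false := by simpa using hω
    have hω' : flipC f ω f = true := by simp [flipC_apply_self, hω0]
    rw [rsigF_of_false Z₁ u u' a₁ R hf hω0, bsig_of_false Z₁ u u' a₁ hf hω0, rsigF_of_true Z₁ u u' a₁ R hf hω',
      bsig_of_true Z₁ u u' a₁ hf hω']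
    unfold flipC
    rw [rsigF_update_nonfree Z₁ u u' a₁ R st f hd, bsig_update_nonfree Z₁ u u' a₁ st f ha]
    simp only [hω0, wt, Bool.not_false, if_true, Bool.false_eq_true, if_false]
    ring

/-- Twice the weighted excess at a free edge `f`, with the weight of `f` split off. -/
theorem two_mul_esymW (R : E₁ → Prop) (st : E₁ → EStat) (w : E₁ → ℚ) (f : E₁) (hf : st f = .free) :
    2 * esymW Z₁ u u' a₁ R st w = ∑ ω : E₁ → Bool, cwt' f w ω *
      (w f * (Fsym (rsigF Z₁ u u' a₁ R (Function.update st f .double) ω)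
          (bsig Z₁ u u' a₁ (Function.update st f .absent) ω) : ℚ)
        + (1 - w f) * (Fsym (rsigF Z₁ u u' a₁ R (Function.update st f .absent) ω)
          (bsig Z₁ u u' a₁ (Function.update st f .double) ω) : ℚ)) := by
  have hflip : ∑ ω : E₁ → Bool, cwt w ω * (Fsym (rsigF Z₁ u u' a₁ R st ω) (bsig Z₁ u u' a₁ st ω) : ℚ) =
      ∑ ω : E₁ → Bool, cwt w (flipC f ω) *
        (Fsym (rsigF Z₁ u u' a₁ R st (flipC f ω)) (bsig Z₁ u u' a₁ st (flipC f ω)) : ℚ) :=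
    (Equiv.sum_comp (flipPerm f)
      (fun ω => cwt w ω * (Fsym (rsigF Z₁ u u' a₁ R st ω) (bsig Z₁ u u' a₁ st ω) : ℚ))).symm
  have h2 : 2 * esymW Z₁ u u' a₁ R st w = ∑ ω : E₁ → Bool,
      (cwt w ω * (Fsym (rsigF Z₁ u u' a₁ R st ω) (bsig Z₁ u u' a₁ st ω) : ℚ)
        + cwt w (flipC f ω) *
          (Fsym (rsigF Z₁ u u' a₁ R st (flipC f ω)) (bsig Z₁ u u' a₁ st (flipC f ω)) : ℚ)) := by
    rw [Finset.sum_add_distrib, ← hflip, esymW]; ring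
  rw [h2]
  exact Finset.sum_congr rfl fun ω _ => summandW_add_flip Z₁ u u' a₁ R st w f hf ω

/-- Twice the weighted excess of a status in which `f` is not free, with the weight of `f` removed. -/
theorem two_mul_esymW_nonfree (R : E₁ → Prop) (st : E₁ → EStat) (w : E₁ → ℚ) (f : E₁) {s : EStat}
    (hs : s ≠ .free) :
    2 * esymW Z₁ u u' a₁ R (Function.update st f s) w = ∑ ω : E₁ → Bool, cwt' f w ω *
      (Fsym (rsigF Z₁ u u' a₁ R (Function.update st f s) ω) (bsig Z₁ u u' a₁ (Function.update st f s) ω) : ℚ) := by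
  unfold esymW
  refine two_mul_sum_cwt_eq f w _ fun ω => ?_
  unfold flipC
  rw [rsigF_update_nonfree Z₁ u u' a₁ R st f hs, bsig_update_nonfree Z₁ u u' a₁ st f hs]

/-- **THE WEIGHTED RECURSION** (as an inequality): at a free edge `f` of probability `p = w f ∈ [0, 1]`, the
weighted excess is at least `(2p − 1)` times the excess with `f` forced red plus `(1 − p)` times the excess of the
deletion plus the excess of the contraction — THE MIXTURE of a forced-red edge and a fair one, and THE KEY LEMMA
(the coefficient `2p − 1` is non-negative exactly when `p ≥ ½`). -/
theorem esymW_rec_ge (R : E₁ → Prop) (st : E₁ → EStat) (w : E₁ → ℚ) (hw : ∀ e, 0 ≤ w e ∧ w e ≤ 1) (f : E₁)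
    (hf : st f = .free) :
    (2 * w f - 1) * esymW Z₁ u u' a₁ (fun e => R e ∨ e = f) (Function.update st f .absent) w
      + (1 - w f) * (esymW Z₁ u u' a₁ R (Function.update st f .absent) w
        + esymW Z₁ u u' a₁ R (Function.update st f .double) w) ≤ esymW Z₁ u u' a₁ R st w := by
  have hd : EStat.double ≠ EStat.free := by decide
  have ha : EStat.absent ≠ EStat.free := by decide
  have hT := two_mul_esymW Z₁ u u' a₁ R st w f hf
  have hA := two_mul_esymW_nonfree Z₁ u u' a₁ R st w f ha
  have hD := two_mul_esymW_nonfree Z₁ u u' a₁ R st w f hd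
  have hF := two_mul_esymW_nonfree Z₁ u u' a₁ (fun e => R e ∨ e = f) st w f ha
  simp only [rsigF_forced_eq Z₁ u u' a₁ R st f] at hF
  have h1w : 0 ≤ 1 - w f := by linarith [(hw f).2]
  -- the pointwise comparison
  have hpt : ∑ ω : E₁ → Bool, cwt' f w ω * ((2 * w f - 1) *
        (Fsym (rsigF Z₁ u u' a₁ R (Function.update st f .double) ω)
          (bsig Z₁ u u' a₁ (Function.update st f .absent) ω) : ℚ)
      + (1 - w f) * ((Fsym (rsigF Z₁ u u' a₁ R (Function.update st f .absent) ω)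
          (bsig Z₁ u u' a₁ (Function.update st f .absent) ω) : ℚ)
        + (Fsym (rsigF Z₁ u u' a₁ R (Function.update st f .double) ω)
          (bsig Z₁ u u' a₁ (Function.update st f .double) ω) : ℚ))) ≤
      ∑ ω : E₁ → Bool, cwt' f w ω *
      (w f * (Fsym (rsigF Z₁ u u' a₁ R (Function.update st f .double) ω)
          (bsig Z₁ u u' a₁ (Function.update st f .absent) ω) : ℚ)
        + (1 - w f) * (Fsym (rsigF Z₁ u u' a₁ R (Function.update st f .absent) ω)
          (bsig Z₁ u u' a₁ (Function.update st f .double) ω) : ℚ)) := by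
    refine Finset.sum_le_sum fun ω _ => mul_le_mul_of_nonneg_left ?_ (cwt'_nonneg hw f ω)
    have hg : (0 : ℚ) ≤ ((gapFr Z₁ u u' a₁ R st f ω : ℤ) : ℚ) := by
      exact_mod_cast gapFr_nonneg Z₁ u u' a₁ R st f ω
    unfold gapFr at hg
    push_cast at hg
    nlinarith [mul_nonneg h1w hg]
  -- assemble: 2 · LHS ≤ 2 · RHS
  have hsplit : ∑ ω : E₁ → Bool, cwt' f w ω * ((2 * w f - 1) *
        (Fsym (rsigF Z₁ u u' a₁ R (Function.update st f .double) ω)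
          (bsig Z₁ u u' a₁ (Function.update st f .absent) ω) : ℚ)
      + (1 - w f) * ((Fsym (rsigF Z₁ u u' a₁ R (Function.update st f .absent) ω)
          (bsig Z₁ u u' a₁ (Function.update st f .absent) ω) : ℚ)
        + (Fsym (rsigF Z₁ u u' a₁ R (Function.update st f .double) ω)
          (bsig Z₁ u u' a₁ (Function.update st f .double) ω) : ℚ))) =
      (2 * w f - 1) * ∑ ω : E₁ → Bool, cwt' f w ω *
        (Fsym (rsigF Z₁ u u' a₁ R (Function.update st f .double) ω)
          (bsig Z₁ u u' a₁ (Function.update st f .absent) ω) : ℚ)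
      + (1 - w f) * (∑ ω : E₁ → Bool, cwt' f w ω *
          (Fsym (rsigF Z₁ u u' a₁ R (Function.update st f .absent) ω)
            (bsig Z₁ u u' a₁ (Function.update st f .absent) ω) : ℚ)
        + ∑ ω : E₁ → Bool, cwt' f w ω *
          (Fsym (rsigF Z₁ u u' a₁ R (Function.update st f .double) ω)
            (bsig Z₁ u u' a₁ (Function.update st f .double) ω) : ℚ)) := by
    rw [mul_add, Finset.mul_sum, Finset.mul_sum, Finset.mul_sum, ← Finset.sum_add_distrib,
      ← Finset.sum_add_distrib]
    exact Finset.sum_congr rfl fun ω _ => by ring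
  rw [hsplit, ← hF, ← hA, ← hD, ← hT] at hpt
  linarith

/-! ## The induction on the free edges -/

/-- **THE WEIGHTED SYMMETRISED EXCESS IS NON-NEGATIVE** for every status, every forced-red set and all edge
probabilities in `[½, 1]` (induction on the number of free edges; the base case is that of THEOREM (FORCED RED)). -/
theorem esymW_nonneg (R : E₁ → Prop) (st : E₁ → EStat) (w : E₁ → ℚ) (hw : ∀ e, 1 / 2 ≤ w e ∧ w e ≤ 1) :
    0 ≤ esymW Z₁ u u' a₁ R st w := by
  have hw01 : ∀ e, 0 ≤ w e ∧ w e ≤ 1 := fun e => ⟨by linarith [(hw e).1], (hw e).2⟩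
  suffices h : ∀ n : ℕ, ∀ (R : E₁ → Prop) (st : E₁ → EStat), nfree st = n → 0 ≤ esymW Z₁ u u' a₁ R st w from
    h _ R st rfl
  intro n
  induction n with
  | zero =>
    intro R st hst
    have hno : ∀ e, st e ≠ .free := by
      intro e he
      have : e ∈ (univ.filter fun e => st e = .free) := by simp [he]
      rw [Finset.card_eq_zero.mp hst] at this
      simp at this
    unfold esymW
    refine Finset.sum_nonneg fun ω _ => mul_nonneg (cwt_nonneg hw01 ω) ?_
    exact_mod_cast Fsym_nonneg_of_le3 _ _ ⟨trans3_rsigF Z₁ u u' a₁ R st ω, trans3_bsig Z₁ u u' a₁ st ω,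
      le3_bsig_rsigF_of_nofree Z₁ u u' a₁ R st hno ω⟩
  | succ n ih =>
    intro R st hst
    have hne : (univ.filter fun e => st e = .free).Nonempty := by
      rw [← Finset.card_pos]; unfold nfree at hst; omega
    obtain ⟨f, hf⟩ := hne
    have hf' : st f = .free := (Finset.mem_filter.mp hf).2
    have h1 := ih (fun e => R e ∨ e = f) (Function.update st f .absent) (by
      have := nfree_update hf' (s := .absent) (by decide); omega)
    have h2 := ih R (Function.update st f .absent) (by
      have := nfree_update hf' (s := .absent) (by decide); omega)
    have h3 := ih R (Function.update st f .double) (by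
      have := nfree_update hf' (s := .double) (by decide); omega)
    have hrec := esymW_rec_ge Z₁ u u' a₁ R st w hw01 f hf'
    have hc1 : 0 ≤ 2 * w f - 1 := by linarith [(hw f).1]
    have hc2 : 0 ≤ 1 - w f := by linarith [(hw f).2]
    have := add_nonneg (mul_nonneg hc1 h1) (mul_nonneg hc2 (add_nonneg h2 h3))
    linarith

/-! ## The host with every edge free: the theorem at every edge probability -/

omit [Fintype E₁] [DecidableEq E₁] in
/-- Without forced edges the forced red pattern is the red pattern. -/
theorem rsigF_false (st : E₁ → EStat) (ω : E₁ → Bool) :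
    rsigF Z₁ u u' a₁ (fun _ => False) st ω = rsig Z₁ u u' a₁ st ω := by
  have h : RAdjF Z₁ (fun _ => False) st ω = RAdjS Z₁ st ω := by
    funext x y
    simp [RAdjF, RAdjS]
  simp only [rsigF, rsig, RdF, RdS, Prod.mk.injEq, decide_eq_decide, h, iff_self, and_self]

/-- **THEOREM (THE SYMMETRIC EXCESS AT EVERY EDGE PROBABILITY ≥ ½)**: for the host with every edge `e` red with
probability `w e ∈ [½, 1]`, the expectation of `Fsym (π_R) (π_B)` — i.e. `P(⊤,⊥) + P(⊥,⊤) − Σ_{i ≠ j} P(s_i, s_j)` —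
is non-negative. -/
theorem esymP_nonneg_of_half_le (w : E₁ → ℚ) (hw : ∀ e, 1 / 2 ≤ w e ∧ w e ≤ 1) :
    0 ≤ ∑ ω : E₁ → Bool, cwt w ω *
      (Fsym (rsig Z₁ u u' a₁ (fun _ => EStat.free) ω) (bsig Z₁ u u' a₁ (fun _ => EStat.free) ω) : ℚ) := by
  have h := esymW_nonneg Z₁ u u' a₁ (fun _ => False) (fun _ => EStat.free) w hw
  unfold esymW at h
  simpa only [rsigF_false] using h

end MultiExit

end ZoneZ

end PercRepro
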